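import Literature.NumberTheory.LFunctions.TaoLogElliottCircleMethod
import Literature.NumberTheory.LFunctions.TaoLogElliottTheorem23
import HarnessLib

/-!
# Tao's log-averaged Elliott theorem: the deterministic end of §3

Glue between the proved Lemma 3.6 (`Literature.NumberTheory.LFunctions.Tao2016.lemma36`, `TaoLogElliottCircleMethod.lean`) and
the shape in which the core of the proof of Theorem 2.3 (`Literature.NumberTheory.LFunctions.Tao2016_theorem23_core`,
`TaoLogElliottTheorem23.lean`) receives its only analytic input, the bound (2.10) on the short
exponential sums `Literature.shortExpSum g n H α = ∑_{j=1}^H g(n+j) e(jα)`.  Everything here is PROVED: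

* `Literature.Tao2016.seqAt g m` — the sequence `j ↦ g(m + j)` on `ℤ` (the `x_{i,j}(𝐧) = g_i(a𝐧 + j)` of
  the paper, `m = a𝐧`), and `norm_dft_seqAt`:
  `|G₁(ξ)| = |dft H (seqAt g m) ξ| = (1/H) |shortExpSum g m H (-ξ/H)|`, identifying the
  large-frequency sum of Lemma 3.6 with the quantity bounded by (2.10)/(2.11);
* `Literature.NumberTheory.LFunctions.Tao2016.endgame` — **from (3.14) to the display before Lemma 3.7**: if `𝐧` is distributed
  on a finite set with weights `w ≥ 0`, `∑ w = 1`, the sequences `x₁(𝐧), x₂(𝐧)` are `1`-bounded on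
  `[1, H]`, `|𝔼 bilinC(x₁(𝐧), x₂(𝐧))| ≥ κ H/log H` ((3.14), `κ ≍ ε`) and
  `𝔼 |G₁(ξ)(𝐧)| ≤ τ` for every `ξ ∈ Ξ_H` ((2.11), `τ = o(1)`), then `κ ≤ (6 + 3|h|)(ε² + |Ξ_H| τ)`
  (Lemma 3.6 averaged over `𝐧`; with `|Ξ_H| ≪_{a,h,ε} 1` from Lemma 3.7 this is the contradiction
  `ε ≪_{a,h} o(|Ξ_H|)` of the paper).

## References
* T. Tao, *The logarithmically averaged Chowla and Elliott conjectures for two-point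
  correlations*, Forum Math. Pi 4 (2016), e8; arXiv:1509.05422, §3, from (3.14) to Lemma 3.7,
  and (2.10)–(2.11).
-/

open Finset Real Complex

namespace Literature.NumberTheory.LFunctions

namespace Tao2016

open VdC

/-- The sequence `j ↦ g(m + j)` (`j ∈ ℤ`, junk `g 0` for `m + j ≤ 0`): the rows
`x_{i,j}(𝐧) = g_i(a𝐧 + j)` of Tao 2016, §2 (definition of `X_H`), with `m = a𝐧`.
[cite: TaoFMP2016, §2 (definition of X_H before Remark 2.7)] -/
def seqAt (g : ℕ → ℂ) (m : ℕ) : ℤ → ℂ := fun j => g (Int.toNat (m + j))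

/-- `seqAt g m j = g (m + j)` for natural `j`. [folklore] -/
theorem seqAt_natCast (g : ℕ → ℂ) (m j : ℕ) : seqAt g m j = g (m + j) := by
  unfold seqAt
  rw [show ((m : ℤ) + (j : ℤ)) = ((m + j : ℕ) : ℤ) by push_cast; rfl, Int.toNat_natCast]

/-- `seqAt g m` is `1`-bounded on `[1, H]` when `g` is unimodular on `ℕ₊`. [folklore] -/
theorem norm_seqAt_le {g : ℕ → ℂ} (hg : ∀ n : ℕ, 1 ≤ n → ‖g n‖ = 1) (m H : ℕ) :
    ∀ j ∈ Icc (1 : ℤ) H, ‖seqAt g m j‖ ≤ 1 := by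
  intro j hj
  rw [mem_Icc] at hj
  unfold seqAt
  rw [hg _ (by omega)]

/-- **The large-frequency quantity of Lemma 3.6 is a short exponential sum**:
`|dft H (seqAt g m) ξ| = (1/H) |∑_{j=1}^H g(m+j) e(-jξ/H)| = (1/H) |shortExpSum g m H (-ξ/H)|`.
[folklore] -/
theorem norm_dft_seqAt (H : ℕ) (g : ℕ → ℂ) (m : ℕ) (ξ : ℤ) :
    ‖dft H (seqAt g m) ξ‖ = ‖shortExpSum g m H (-(ξ : ℝ) / H)‖ / H := by
  unfold dft shortExpSum
  rw [norm_mul, norm_div, norm_one, Complex.norm_natCast, one_div, mul_comm, ← div_eq_mul_inv]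
  congr 1
  -- identify the two sums
  have h1 : ∑ j ∈ Icc (1 : ℤ) H, seqAt g m j * e (-(j * ξ / H)) =
      ∑ j ∈ Icc 1 H, g (m + j) * Complex.exp (2 * Real.pi * Complex.I * (j : ℂ) *
        ((-(ξ : ℝ) / H : ℝ) : ℂ)) := by
    have h2 : ∑ j ∈ Icc (1 : ℤ) H, seqAt g m j * e (-(j * ξ / H)) =
        ∑ k ∈ range H, seqAt g m (1 + k) * e (-((1 + k) * ξ / H)) := by
      rw [Int.Icc_eq_finset_map, sum_map]
      simp
    have h3 : ∑ j ∈ Icc 1 H, g (m + j) * Complex.exp (2 * Real.pi * Complex.I * (j : ℂ) *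
        ((-(ξ : ℝ) / H : ℝ) : ℂ)) =
        ∑ k ∈ range H, g (m + (1 + k)) * Complex.exp (2 * Real.pi * Complex.I * ((1 + k : ℕ) : ℂ) *
          ((-(ξ : ℝ) / H : ℝ) : ℂ)) := by
      rw [← Finset.Ico_add_one_right_eq_Icc, Finset.sum_Ico_eq_sum_range]
      simp
    rw [h2, h3]
    refine sum_congr rfl fun k _ => ?_
    rw [show ((1 : ℤ) + (k : ℤ)) = ((1 + k : ℕ) : ℤ) by push_cast; rfl, seqAt_natCast]
    congr 1
    unfold VdC.e
    congr 1
    push_cast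
    ring
  rw [h1]

/-- **The end of the proof of Theorem 2.3, deterministic part** (Tao 2016, §3, from (3.14) to the
display `ε ≪_{a,h} o_{H₋→∞}(|Ξ_H|)` before Lemma 3.7): let `𝐧` be distributed on a finite set `S`
with weights `w ≥ 0`, `∑ w = 1`, and let `x₁(𝐧), x₂(𝐧)` be `1`-bounded sequences on `[1, H]`
(in the paper `x_{i,j}(𝐧) = g_i(a𝐧 + j)`, i.e. `seqAt gᵢ (a𝐧)`).  If
`|𝔼 ∑_{p∈𝒫_H} (c_p/p) ∑_{j, j+ph ∈ [1,H], j ≡ pb (a)} x_{1,j}(𝐧) x_{2,j+ph}(𝐧)| ≥ κ H / log H`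
((3.14) with `κ ≍ ε`) and `𝔼 |(1/H) ∑_{j=1}^H x_{1,j}(𝐧) e(-jξ/H)| ≤ τ` for every `ξ ∈ Ξ_H`
((2.11) with `τ = o_{H₋→∞}(1)`), then Lemma 3.6 gives `κ ≤ (6 + 3|h|)(ε² + |Ξ_H| τ)`.
[cite: TaoFMP2016, §3 (from (3.14) to Lemma 3.7)] -/
theorem endgame {ι : Type*} (S : Finset ι) (w : ι → ℝ) (hw0 : ∀ n ∈ S, 0 ≤ w n)
    (hw1 : ∑ n ∈ S, w n = 1) {a H : ℕ} (ha : 0 < a) (haH : a ∣ H) (b h : ℤ) {ε : ℝ}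
    (hε : 0 < ε) (hε1 : ε ≤ 1) (hH : 4 ≤ ε ^ 4 * H) (c : ℕ → ℂ)
    (hc : ∀ p ∈ primesP ε H, ‖c p‖ ≤ 1) (x₁ x₂ : ι → ℤ → ℂ)
    (hx₁ : ∀ n ∈ S, ∀ j ∈ Icc (1 : ℤ) H, ‖x₁ n j‖ ≤ 1)
    (hx₂ : ∀ n ∈ S, ∀ j ∈ Icc (1 : ℤ) H, ‖x₂ n j‖ ≤ 1) {κ τ : ℝ}
    (hlow : κ * (H / Real.log H) ≤
      ‖∑ n ∈ S, (w n : ℂ) * bilinC H a b h (primesP ε H) c (x₁ n) (x₂ n)‖)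
    (hup : ∀ ξ ∈ Xi (primesP ε H) c a H b h (ε ^ 2 / Real.log H),
      ∑ n ∈ S, w n * ‖dft H (x₁ n) ξ‖ ≤ τ) :
    κ ≤ (6 + 3 * |(h : ℝ)|) *
      (ε ^ 2 + (Xi (primesP ε H) c a H b h (ε ^ 2 / Real.log H)).card * τ) := by
  set Ξ := Xi (primesP ε H) c a H b h (ε ^ 2 / Real.log H) with hΞ
  have hε4 : ε ^ 4 ≤ 1 := pow_le_one₀ hε.le hε1
  have hH4 : (4 : ℝ) ≤ H := by nlinarith [hH, (Nat.cast_nonneg H : (0 : ℝ) ≤ H)]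
  have hlogH : 0 < Real.log H := Real.log_pos (by linarith)
  have hHL : 0 < (H : ℝ) / Real.log H := by positivity
  -- pointwise Lemma 3.6
  have h36 : ∀ n ∈ S, ‖bilinC H a b h (primesP ε H) c (x₁ n) (x₂ n)‖ ≤
      (6 + 3 * |(h : ℝ)|) * (H / Real.log H) * (ε ^ 2 + ∑ ξ ∈ Ξ, ‖dft H (x₁ n) ξ‖) :=
    fun n hn => lemma36 ha haH b h hε hε1 hH c hc (x₁ n) (x₂ n) (hx₁ n hn) (hx₂ n hn)
  -- average
  have h1 : ‖∑ n ∈ S, (w n : ℂ) * bilinC H a b h (primesP ε H) c (x₁ n) (x₂ n)‖ ≤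
      ∑ n ∈ S, w n * ((6 + 3 * |(h : ℝ)|) * (H / Real.log H) *
        (ε ^ 2 + ∑ ξ ∈ Ξ, ‖dft H (x₁ n) ξ‖)) := by
    refine (norm_sum_le _ _).trans (sum_le_sum fun n hn => ?_)
    rw [norm_mul, Complex.norm_real, Real.norm_eq_abs, abs_of_nonneg (hw0 n hn)]
    exact mul_le_mul_of_nonneg_left (h36 n hn) (hw0 n hn)
  have h2 : ∑ n ∈ S, w n * ((6 + 3 * |(h : ℝ)|) * (H / Real.log H) *
        (ε ^ 2 + ∑ ξ ∈ Ξ, ‖dft H (x₁ n) ξ‖)) =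
      (6 + 3 * |(h : ℝ)|) * (H / Real.log H) *
        (ε ^ 2 + ∑ ξ ∈ Ξ, ∑ n ∈ S, w n * ‖dft H (x₁ n) ξ‖) := by
    have e1 : ∀ n : ι, w n * ((6 + 3 * |(h : ℝ)|) * (H / Real.log H) *
        (ε ^ 2 + ∑ ξ ∈ Ξ, ‖dft H (x₁ n) ξ‖)) =
        (6 + 3 * |(h : ℝ)|) * (H / Real.log H) * (w n * ε ^ 2) +
        (6 + 3 * |(h : ℝ)|) * (H / Real.log H) * (w n * ∑ ξ ∈ Ξ, ‖dft H (x₁ n) ξ‖) := by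
      intro n; ring
    simp_rw [e1]
    rw [sum_add_distrib, ← mul_sum, ← mul_sum, ← sum_mul, hw1, one_mul, ← mul_add]
    congr 2
    simp_rw [mul_sum]
    exact sum_comm
  have h3 : ∑ ξ ∈ Ξ, ∑ n ∈ S, w n * ‖dft H (x₁ n) ξ‖ ≤ Ξ.card * τ := by
    calc ∑ ξ ∈ Ξ, ∑ n ∈ S, w n * ‖dft H (x₁ n) ξ‖ ≤ ∑ ξ ∈ Ξ, τ := sum_le_sum hup
      _ = Ξ.card * τ := by rw [sum_const, nsmul_eq_mul]
  have h4 : κ * (H / Real.log H) ≤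
      (6 + 3 * |(h : ℝ)|) * (H / Real.log H) * (ε ^ 2 + Ξ.card * τ) := by
    refine hlow.trans (h1.trans ?_)
    rw [h2]
    gcongr
  have h5 : κ * (H / Real.log H) ≤ ((6 + 3 * |(h : ℝ)|) * (ε ^ 2 + Ξ.card * τ)) *
      (H / Real.log H) := by linarith [h4]
  exact le_of_mul_le_mul_right h5 hHL

end Tao2016
end Literature.NumberTheory.LFunctions
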